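import Summits.BirchSwinnertonDyer.Rank1Residual.Additive.ChiBranchInputBigImage
import Summits.BirchSwinnertonDyer.Rank1Residual.Additive.X3RankZeroSemistableTwistOdd
import Literature.NumberTheory.EllipticCurves.Rank1Residual.Typed.X4
import HarnessLib

/-!
# X4 ∧ `r_an = 0` ∧ (semistable twist), `p ≡ 3 (mod 4)` — toward X4♯(3): `ord_p #Ш(E) ≤ ord_p #Ш_an(E) + ord_p c_p(E)` from the typed Kato-branch input (cell `b2b-bsdres`, seat additive-p4, line V9b)

HONEST FRAMING (cell `b2b-bsdres`, run/shared/lean/b2b/bsd-rank1-residual/, verbatim in every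
file): the goal of the cell is to DELETE the COMBINATION-SHAPED residual classes of the
Birch–Swinnerton-Dyer formula for ALL analytic-rank `≤ 1` elliptic curves over `ℚ` — "full BSD
formula for every rank `≤ 1` curve in class `C`" assembled STRICTLY from published theorems — so
that the rank-`≤ 1` remainder becomes exactly the CONSTRUCTION-SHAPED classes, which are TYPED
(missing-input `Prop`s), NOT attempted. This is not "finishing BSD". The additive sub-cell (seats
additive-p1…p4) is a RESEARCH ROUTE on the construction-shaped classes X3/X4; no claim beyond the
stated classes; the label of X4 is UNCHANGED (its one non-published input is TYPED).

Theorems only (no definition, no new named fact). The line V9b of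
HOME/b2b-bsdres-additive-p4/REPAIR-CENSUS.md: the sharpened conjecture **X4♯(3)** (Kim's inequality
at `p = 3`; SHARPENED-CONJECTURES §4; Lean statement `X4SharpThree`) has NOTHING in print on its
1582 ‖ 417 rank-`0` rows (Kim 2026 Thm. 1.8 needs `p ≥ 5`; Kim–Nakamura 2020 at `p = 3` awaits a
ruling). On the rows whose twist `E♭ = E ⊗ χ_{−3}` is SEMISTABLE at `3` — (M) 861 + (e = 2, twist
ordinary) 245 = 1106 of them — the V9 mechanism applies VERBATIM with Kato's big-image divisibility
for `E♭` (Astérisque 295 Thm. 17.4 (3) / 12.5 (4): odd `p`, `ρ_{E♭,p^∞}` onto) in place of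
Wuthrich's reducible one, because Delbourgo 1998 Prop. 4 [A] carries NO image hypothesis:

* `AdditiveTwistOdd.shaOrder_le_of_leadingTerm` — the class-agnostic core (`Addv W p` only) of the
  odd assembly of `X3RankZeroSemistableTwistOdd.lean` (same proof);
* `X4RankZeroTwistOdd.shaOrder_le` — **X4 ∧ `r_an = 0` ∧ (`W = C • V^{(−p)}`, `V` good ordinary or
  multiplicative at `p`, `ρ_{V,p^∞}` onto) ∧ `p ≡ 3 (mod 4)`, granted the typed input
  `ChiBranchLeadingTermOddBigImageAt W p` (p. [B'∘C](0)): `#Ш_an(E) = q ∈ ℚ` with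
  `ord_p #Ш(E) ≤ ord_p q + ord_p c_p(E)`** from Delbourgo 1998 Prop. 4 (`hDel`), GZK (`hGZK`),
  modularity (`hmod`) and tree theorems; `X4RankZeroTwistOdd.missingUpperBoundAt` (`p ∤ c_p(E)`;
  at `p = 3` the bit `c_3 ∈ {1,2,4}`, true for `I₀*`/`I_n*`), `.bsdp_of_shaAn_unit` (**`BSD(E,3)` on
  the `3 ∤ c_3·#Ш_an` rows**, no Kurihara number), `.missingPPartAt_iff_lower`.
At `p ≥ 5` the X4 upper bound is Kim's theorem unconditionally (`X4RankZeroUpperBound.lean`,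
p199532); this file matters at `p = 3` (and records the mechanism for every `p ≡ 3 (mod 4)`).

References: Kato 2004 [Kato2004Asterisque] Thm. 17.4 (3), 12.5 (4); Delbourgo 1998 [Delbourgo1998]
Prop. 4; Pal 2012 [Pal2012] Thm. 3.2; Mazur–Tate–Teitelbaum 1986 [MazurTateTeitelbaum1986Invent]
§I.8, §I.14; Kim 2026 [Kim2022StructureSelmer] Thm. 1.8 (the `p ≥ 5` comparison); Miller 2011
[Miller2011LMS] Def. 1.1.
-/

noncomputable section

open scoped Classical MatrixGroups ModularForm

open CongruenceSubgroup WeierstrassCurve Literature.NumberTheory.EllipticCurves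
  Literature.NumberTheory.EllipticCurves.ModularForms
  Literature.NumberTheory.EllipticCurves.Rank1Residual

namespace Summit.BirchSwinnertonDyer.Rank1Residual.Additive

section AssemblyOddBigImage

open IsDedekindDomain NumberField Rat.HeightOneSpectrum
  Literature.NumberTheory.EllipticCurves.Rank1Residual.Typed

variable (W : WeierstrassCurve ℚ) [W.IsElliptic] [W.IsGloballyMinimal] (p : ℕ) [hp : Fact p.Prime]

/-- **Class-agnostic core (line V9/V9b, rank 0, `p ≡ 3 (mod 4)`).** As
`X3RankZeroTwistOdd.shaOrder_le_of_leadingTerm` (p203966) but assuming only that `E = W` is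
ADDITIVE at `p` (`Addv W p`), not that `E[p]` is reducible: the image hypothesis enters only
through the pointwise leading-term statement `hLT`, which the X3 file feeds from the Wuthrich-shaped
typed input and this file (below) from the Kato-shaped one. For `W = C • V^{(−p)}`, `V` good
ordinary or multiplicative at `p`, `ord_p u(C) = 0`, `f` the newform of `V`, `ϖ⁻·|Ω⁻(V)| = Ω⁻_f`:
Delbourgo 1998 Prop. 4 (`hDel`) + `hLT` + odd Birch + Pal (`d < 0`) + Kodaira–Néron + GZK +
modularity ⇒ `#Ш_an(E) = q ∈ ℚ` with **`ord_p #Ш(E) ≤ ord_p q + ord_p c_p(E)`**. -/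
theorem AdditiveTwistOdd.shaOrder_le_of_leadingTerm
    (hDel : Delbourgo1998.prop4_rankZero_pow_dvd_constantCoeff)
    (hGZK : rank_eq_analyticRank_of_analyticRank_le_one) (hmod : hasEntireLFunction_rat)
    (hp4 : p % 4 = 3) (hr : W.analyticRank = 0) (hadd : Addv W p)
    (V : WeierstrassCurve ℚ) [V.IsElliptic] [V.IsGloballyMinimal]
    (C : VariableChange ℚ) (hC : C • V.quadraticTwist (-(p : ℚ)) = W) (hV : GoodOrd V p ∨ Mult V p)
    (hu : padicValRat p (C.u : ℚ) = 0)
    {N : ℕ} [NeZero N] {f : CuspForm (Gamma0 N) 2} (hf : IsNewformOf V f)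
    (ϖ : ℚ) (hϖ : (ϖ : ℝ) * V.imaginaryPeriodRat = minusPeriod f)
    (hLT : ∀ (κ : ZpExtension ℚ p) (γ : Field.absoluteGaloisGroup ℚ),
      κ.IsCyclotomic → κ.IsTopGenerator γ → IsCyclotomicVariable p γ →
      ∀ D : W.SelmerDualData κ γ, ∃ g ∈ D.charIdeal, ∃ u : ℤ_[p]ˣ,
        ((PowerSeries.constantCoeff g : ℤ_[p]) : ℚ_[p]) =
          ((u : ℤ_[p]) : ℚ_[p]) * (ϖ : ℚ_[p]) * (legendreMinusSymbolSum f p : ℚ_[p])) :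
    ∃ q : ℚ, shaAn W = (q : ℂ) ∧
      (padicValNat p W.shaOrder : ℤ) ≤
        padicValRat p q + padicValNat p (W.tamagawaNumberAt ((primesEquiv (R := 𝓞 ℚ)).symm ⟨p, hp.out⟩)) := by
  classical
  have hpP : p.Prime := hp.out
  have hp2 : p ≠ 2 := by omega
  set v₀ : HeightOneSpectrum (𝓞 ℚ) := (primesEquiv (R := 𝓞 ℚ)).symm ⟨p, hp.out⟩ with hv₀
  -- rank 0: `L(E,1) ≠ 0`, `E(ℚ)` and `Ш` finite
  have hL : W.entireLFunction 1 ≠ 0 := (W.analyticRank_eq_zero_iff_holds (hmod W)).mp hr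
  obtain ⟨hmw, hfin⟩ := hGZK W (by rw [hr]; exact zero_le_one)
  have hmw0 : W.mordellWeilRank = 0 := by rw [hmw, hr]
  haveI : Finite W.sha := hfin
  haveI hE : Finite W.toAffine.Point := W.finite_point_of_rank_zero hmw0
  -- the cyclotomic setting and `X(E/ℚ_∞)`
  obtain ⟨κ, hκ, γ, hγ, hγ'⟩ := exists_isCyclotomic_isTopGenerator_isCyclotomicVariable_holds p
  obtain ⟨D⟩ := W.nonempty_selmerDualData_holds κ γ hγ
  -- [B∘C](0), odd branch
  obtain ⟨g, hgmem, u, hg0⟩ := hLT κ γ hκ hγ hγ' D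
  -- [A]: Delbourgo 1998 Prop. 4
  have hGM := typeGOrd_or_padicValRat_j_neg_of_twist_neg W p hp4 V ⟨C, hC⟩ hV
  obtain ⟨-, hdiv⟩ := hDel W p hp2 hadd hGM hr hfin hE κ γ hκ hγ D
  have hdvd := hdiv g hgmem
  -- [E⁻] + [F] + odd Birch
  obtain ⟨ε, hε, hLq⟩ := entireLFunction_one_eq_of_twist_neg p hmod hp4 V W C hC hadd hf ϖ hϖ
  set S : ℚ := legendreMinusSymbolSum f p with hS
  set cinf : ℕ := (W.baseChange ℝ).numRealComponents with hcinf
  set q : ℚ := ε * (ϖ * S) / (|(C.u : ℚ)| * (cinf : ℚ)) with hq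
  have hΩ : (W.realPeriodRat : ℂ) ≠ 0 := by exact_mod_cast W.realPeriodRat_pos_holds.ne'
  have hq' : W.entireLFunction 1 / (W.realPeriodRat : ℂ) = (q : ℂ) := by
    rw [hLq, mul_div_cancel_right₀ _ hΩ]
  obtain ⟨-, -, -, hshaAn⟩ := Wuthrich2014.shaAn_eq_of_L_one_div_eq hGZK W hL hq'
  -- non-vanishing and the valuation of `q`
  have hua0 : |(C.u : ℚ)| ≠ 0 := abs_ne_zero.mpr C.u.ne_zero
  have hcinf0 : (cinf : ℚ) ≠ 0 := by
    rw [hcinf, numRealComponents]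
    split_ifs <;> norm_num
  have hden0 : |(C.u : ℚ)| * (cinf : ℚ) ≠ 0 := mul_ne_zero hua0 hcinf0
  have hϖS : ϖ * S ≠ 0 := by
    intro h0
    apply hL
    rw [hLq, hq, h0, mul_zero, zero_div, Rat.cast_zero, zero_mul]
  have hε0 : ε ≠ 0 := by rcases hε with h | h <;> rw [h] <;> norm_num
  have hq0 : q ≠ 0 := by
    rw [hq]
    exact div_ne_zero (mul_ne_zero hε0 hϖS) hden0
  have hvε : padicValRat p ε = 0 := by
    rcases hε with h | h
    · rw [h, padicValRat.one]
    · rw [h, padicValRat.neg, padicValRat.one]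
  have hvua : padicValRat p |(C.u : ℚ)| = 0 := by
    rcases abs_choice (C.u : ℚ) with h | h
    · rw [h, hu]
    · rw [h, padicValRat.neg, hu]
  have hvq : padicValRat p q = padicValRat p (ϖ * S) := by
    rw [hq, padicValRat.div (mul_ne_zero hε0 hϖS) hden0, padicValRat.mul hε0 hϖS,
      padicValRat.mul hua0 hcinf0, hvε, hvua, padicValRat_numRealComponents_eq_zero W p hp2]
    ring
  -- names for the arithmetic quantities
  set T : ℕ := Nat.card W.toAffine.Point with hT
  set c : ℕ := W.tamagawaNumberAt v₀ with hc
  set P' : ℕ := ∏ᶠ v : HeightOneSpectrum (𝓞 ℚ),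
    (if (p : 𝓞 ℚ) ∈ v.asIdeal then 1 else W.tamagawaNumberAt v) with hP'
  have hT0 : T ≠ 0 := by rw [hT]; exact Nat.card_pos.ne'
  have hPsplit : W.tamagawaProduct = c * P' := tamagawaProduct_eq_tamagawaNumberAt_mul_finprod W p
  have hPpos : 0 < W.tamagawaProduct := W.tamagawaProduct_pos_holds
  have hc0 : c ≠ 0 := fun h ↦ by rw [hPsplit, h, zero_mul] at hPpos; exact lt_irrefl 0 hPpos
  have hP'0 : P' ≠ 0 := fun h ↦ by rw [hPsplit, h, mul_zero] at hPpos; exact lt_irrefl 0 hPpos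
  have hvP : padicValNat p W.tamagawaProduct = padicValNat p c + padicValNat p P' := by
    rw [hPsplit, padicValNat.mul hc0 hP'0]
  have hsha : padicValNat p (Nat.card (AddCommGroup.primaryComponent W.sha p)) =
      padicValNat p W.shaOrder := by
    unfold WeierstrassCurve.shaOrder
    exact padicValNat_card_addPrimaryComponent p
  -- the divisibility in `ℤ_p`, read as an inequality of valuations in `ℚ_p`
  set g0 : ℚ_[p] := ((PowerSeries.constantCoeff g : ℤ_[p]) : ℚ_[p]) with hg0def
  have hg0S : g0 = ((u : ℤ_[p]) : ℚ_[p]) * ((ϖ * S : ℚ) : ℚ_[p]) := by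
    rw [hg0]
    push_cast
    ring
  have hϖSQ : ((ϖ * S : ℚ) : ℚ_[p]) ≠ 0 := by exact_mod_cast hϖS
  have hg0ne : g0 ≠ 0 := by
    rw [hg0S]
    exact mul_ne_zero (coe_units_ne_zero p u) hϖSQ
  have hvg0 : g0.valuation = padicValRat p (ϖ * S) := by
    rw [hg0S, Padic.valuation_mul (coe_units_ne_zero p u) hϖSQ, valuation_coe_units_eq_zero,
      zero_add, Padic.valuation_ratCast]
  have hTQ : ((T : ℕ) : ℚ_[p]) ≠ 0 := by exact_mod_cast hT0
  obtain ⟨c', hc'⟩ := hdvd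
  have hkey : g0 * ((T : ℕ) : ℚ_[p]) ^ 2 =
      (p : ℚ_[p]) ^ (padicValNat p (Nat.card (AddCommGroup.primaryComponent W.sha p)) +
        padicValNat p P') * ((c' : ℤ_[p]) : ℚ_[p]) := by
    have h := congrArg ((↑) : ℤ_[p] → ℚ_[p]) hc'
    push_cast at h
    rw [hg0def]
    exact h
  have hlhs0 : g0 * ((T : ℕ) : ℚ_[p]) ^ 2 ≠ 0 := mul_ne_zero hg0ne (pow_ne_zero 2 hTQ)
  have hc'0 : ((c' : ℤ_[p]) : ℚ_[p]) ≠ 0 := by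
    intro h0
    rw [h0, mul_zero] at hkey
    exact hlhs0 hkey
  have hpQ : (p : ℚ_[p]) ≠ 0 := by exact_mod_cast hpP.ne_zero
  have hval := congrArg Padic.valuation hkey
  rw [Padic.valuation_mul hg0ne (pow_ne_zero 2 hTQ), Padic.valuation_pow, Padic.valuation_natCast,
    hvg0, Padic.valuation_mul (pow_ne_zero _ hpQ) hc'0, Padic.valuation_pow, Padic.valuation_p,
    mul_one, hsha] at hval
  have hc'val : 0 ≤ (((c' : ℤ_[p]) : ℚ_[p])).valuation := PadicInt.valuation_coe_nonneg
  have hineq : (padicValNat p W.shaOrder : ℤ) + padicValNat p P' ≤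
      padicValRat p (ϖ * S) + 2 * (padicValNat p T : ℤ) := by
    simp only [Nat.cast_add, Nat.cast_ofNat] at hval
    linarith
  -- conclusion
  refine ⟨q * (T : ℚ) ^ 2 / (W.tamagawaProduct : ℚ), ?_, ?_⟩
  · rw [hshaAn]
  · have hTq : (T : ℚ) ≠ 0 := by exact_mod_cast hT0
    have hPq : (W.tamagawaProduct : ℚ) ≠ 0 := by exact_mod_cast hPpos.ne'
    rw [padicValRat.div (mul_ne_zero hq0 (pow_ne_zero 2 hTq)) hPq,
      padicValRat.mul hq0 (pow_ne_zero 2 hTq), padicValRat.pow, padicValRat.of_nat,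
      padicValRat.of_nat, hvq, hvP]
    simp only [Nat.cast_ofNat, Nat.cast_add]
    linarith


/-- **X4 ∧ `r_an = 0` ∧ (semistable big-image twist) at `p ≡ 3 (mod 4)` — toward X4♯(3)**:
granted `ChiBranchLeadingTermOddBigImageAt W p` (Kato's odd-branch divisibility for `E♭`
transported to `E`, at `T = 0`), for `E = W = C • V^{(−p)}` in class X4 with `V` good ordinary or
multiplicative at `p` and `ρ_{V,p^∞}` surjective: `#Ш_an(E) = q ∈ ℚ` with
`ord_p #Ш(E) ≤ ord_p q + ord_p c_p(E)`. Inputs: Delbourgo 1998 Prop. 4 (`hDel`), GZK, modularity,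
tree theorems (odd Birch, Pal `d < 0`, `u_p = 1`, Kodaira–Néron). -/
theorem X4RankZeroTwistOdd.shaOrder_le
    (hDel : Delbourgo1998.prop4_rankZero_pow_dvd_constantCoeff)
    (hGZK : rank_eq_analyticRank_of_analyticRank_le_one) (hmod : hasEntireLFunction_rat)
    (hBC : ChiBranchLeadingTermOddBigImageAt W p)
    (hp4 : p % 4 = 3) (hr : W.analyticRank = 0) (hX : ClassX4 W p)
    (V : WeierstrassCurve ℚ) [V.IsElliptic] [V.IsGloballyMinimal]
    (C : VariableChange ℚ) (hC : C • V.quadraticTwist (-(p : ℚ)) = W) (hV : GoodOrd V p ∨ Mult V p)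
    (hsurj : ∀ n : ℕ, V.HasSurjectiveModNGaloisRep (p ^ n : ℕ))
    {N : ℕ} [NeZero N] {f : CuspForm (Gamma0 N) 2} (hf : IsNewformOf V f)
    (ϖ : ℚ) (hϖ : (ϖ : ℝ) * V.imaginaryPeriodRat = minusPeriod f) :
    ∃ q : ℚ, shaAn W = (q : ℂ) ∧
      (padicValNat p W.shaOrder : ℤ) ≤
        padicValRat p q + padicValNat p (W.tamagawaNumberAt ((primesEquiv (R := 𝓞 ℚ)).symm ⟨p, hp.out⟩)) := by
  have hC' : C • V.quadraticTwist (((-(p : ℤ)) : ℤ) : ℚ) = W := by push_cast; exact hC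
  have hu : padicValRat p (C.u : ℚ) = 0 :=
    padicValRat_u_eq_zero_of_twist_pm_p p (by omega) V W (hV.elim (fun h ↦ Or.inl h.1) Or.inr)
      (Or.inr rfl) C hC'
  exact AdditiveTwistOdd.shaOrder_le_of_leadingTerm W p hDel hGZK hmod hp4 hr hX.2.1 V C hC hV hu hf ϖ
    hϖ fun _ _ hκ hγ hγ' D ↦ (hBC V hp4 ⟨C, hC⟩ hV hsurj hκ hγ hγ' hf D ϖ hϖ).2

/-- **The typed UPPER half `ord_p #Ш(E) ≤ ord_p #Ш_an(E)` on X4 at `p ≡ 3 (mod 4)`** whenever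
`p ∤ c_p(E)` (automatic for `p ≥ 7`; at `p = 3` the per-pair bit `c_3(E) ∈ {1,2,4}`), granted the
typed Kato-branch input. At `p = 3` this is the "≤" half of the sharpened conjecture X4♯(3) on the
semistable-twist rows. -/
theorem X4RankZeroTwistOdd.missingUpperBoundAt
    (hDel : Delbourgo1998.prop4_rankZero_pow_dvd_constantCoeff)
    (hGZK : rank_eq_analyticRank_of_analyticRank_le_one) (hmod : hasEntireLFunction_rat)
    (hBC : ChiBranchLeadingTermOddBigImageAt W p)
    (hp4 : p % 4 = 3) (hr : W.analyticRank = 0) (hX : ClassX4 W p)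
    (V : WeierstrassCurve ℚ) [V.IsElliptic] [V.IsGloballyMinimal]
    (C : VariableChange ℚ) (hC : C • V.quadraticTwist (-(p : ℚ)) = W) (hV : GoodOrd V p ∨ Mult V p)
    (hsurj : ∀ n : ℕ, V.HasSurjectiveModNGaloisRep (p ^ n : ℕ))
    {N : ℕ} [NeZero N] {f : CuspForm (Gamma0 N) 2} (hf : IsNewformOf V f)
    (ϖ : ℚ) (hϖ : (ϖ : ℝ) * V.imaginaryPeriodRat = minusPeriod f)
    (htam : ¬ p ∣ W.tamagawaNumberAt ((primesEquiv (R := 𝓞 ℚ)).symm ⟨p, hp.out⟩)) :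
    MissingUpperBoundAt W p := by
  obtain ⟨q, hq, hle⟩ :=
    X4RankZeroTwistOdd.shaOrder_le W p hDel hGZK hmod hBC hp4 hr hX V C hC hV hsurj hf ϖ hϖ
  refine ⟨q, hq, ?_⟩
  rw [padicValNat.eq_zero_of_not_dvd htam, Nat.cast_zero, add_zero] at hle
  exact hle

/-- **`BSD(E,p)` on X4 at `p ≡ 3 (mod 4)` — in particular `BSD(E,3)` — on the rows with
`p ∤ c_p(E)·#Ш_an(E)`, granted the typed Kato-branch input**: the one-sided bound pinches
`ord_p #Ш(E) = 0 = ord_p #Ш_an(E)`. No Kurihara number, no Manin-constant hypothesis. -/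
theorem X4RankZeroTwistOdd.bsdp_of_shaAn_unit
    (hDel : Delbourgo1998.prop4_rankZero_pow_dvd_constantCoeff)
    (hGZK : rank_eq_analyticRank_of_analyticRank_le_one) (hmod : hasEntireLFunction_rat)
    (hBC : ChiBranchLeadingTermOddBigImageAt W p)
    (hp4 : p % 4 = 3) (hr : W.analyticRank = 0) (hX : ClassX4 W p)
    (V : WeierstrassCurve ℚ) [V.IsElliptic] [V.IsGloballyMinimal]
    (C : VariableChange ℚ) (hC : C • V.quadraticTwist (-(p : ℚ)) = W) (hV : GoodOrd V p ∨ Mult V p)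
    (hsurj : ∀ n : ℕ, V.HasSurjectiveModNGaloisRep (p ^ n : ℕ))
    {N : ℕ} [NeZero N] {f : CuspForm (Gamma0 N) 2} (hf : IsNewformOf V f)
    (ϖ : ℚ) (hϖ : (ϖ : ℝ) * V.imaginaryPeriodRat = minusPeriod f)
    (htam : ¬ p ∣ W.tamagawaNumberAt ((primesEquiv (R := 𝓞 ℚ)).symm ⟨p, hp.out⟩))
    {q : ℚ} (hq : shaAn W = (q : ℂ)) (hv : padicValRat p q = 0) : BSDp W p :=
  bsdp_of_missingPPartAt W p hGZK (by rw [hr]; exact zero_le_one)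
    (missingPPartAt_of_upper_of_shaAn_unit W p
      (X4RankZeroTwistOdd.missingUpperBoundAt W p hDel hGZK hmod hBC hp4 hr hX V C hC hV hsurj hf ϖ
        hϖ htam) hq hv)

/-- **What remains of X4♯ on these pairs is the LOWER half** (`p ≡ 3 (mod 4)`, `p ∤ c_p(E)`),
granted the typed Kato-branch input: `Typed.X4.MissingInputAt W p ⟺ MissingLowerBoundAt W p`. -/
theorem X4RankZeroTwistOdd.missingPPartAt_iff_lower
    (hDel : Delbourgo1998.prop4_rankZero_pow_dvd_constantCoeff)
    (hGZK : rank_eq_analyticRank_of_analyticRank_le_one) (hmod : hasEntireLFunction_rat)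
    (hBC : ChiBranchLeadingTermOddBigImageAt W p)
    (hp4 : p % 4 = 3) (hr : W.analyticRank = 0) (hX : ClassX4 W p)
    (V : WeierstrassCurve ℚ) [V.IsElliptic] [V.IsGloballyMinimal]
    (C : VariableChange ℚ) (hC : C • V.quadraticTwist (-(p : ℚ)) = W) (hV : GoodOrd V p ∨ Mult V p)
    (hsurj : ∀ n : ℕ, V.HasSurjectiveModNGaloisRep (p ^ n : ℕ))
    {N : ℕ} [NeZero N] {f : CuspForm (Gamma0 N) 2} (hf : IsNewformOf V f)
    (ϖ : ℚ) (hϖ : (ϖ : ℝ) * V.imaginaryPeriodRat = minusPeriod f)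
    (htam : ¬ p ∣ W.tamagawaNumberAt ((primesEquiv (R := 𝓞 ℚ)).symm ⟨p, hp.out⟩)) :
    X4.MissingInputAt W p ↔ MissingLowerBoundAt W p :=
  ⟨fun h ↦ (lower_and_upper_of_missingPPartAt W p h).1, fun h ↦
    missingPPartAt_of_lower_of_upper W p h
      (X4RankZeroTwistOdd.missingUpperBoundAt W p hDel hGZK hmod hBC hp4 hr hX V C hC hV hsurj hf ϖ
        hϖ htam)⟩

end AssemblyOddBigImage

end Summit.BirchSwinnertonDyer.Rank1Residual.Additive

end
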